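import Literature.NumberTheory.LFunctions.LittlewoodOscillationInputsAverageProofs
import Literature.NumberTheory.LFunctions.SchoenfeldZeroSumsExplicit
import HarnessLib

/-!
# Littlewood's theorem for `ψ` under RH: `ψ(x) − x = Ω±(x^{1/2} log log log x)` (MV Thm. 15.11, RH case)

Topic `Literature/NumberTheory/LFunctions`. THEOREMS (everything proved; MV Lemma 15.9 enters through
its discharge `Literature.NumberTheory.LFunctions.MontgomeryVaughan2007_lemma15_9_holds`,
`LittlewoodOscillationInputsAverageProofs.lean`).

Montgomery–Vaughan, *Multiplicative Number Theory I*, Theorem 15.11 (Littlewood 1914), (15.22), in the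
case that the Riemann Hypothesis holds ("If RH is false, then Theorem 15.2 is stronger. Thus it
remains to prove (15.22) if RH holds"):

* `Literature.NumberTheory.LFunctions.LittlewoodRH.chebyshevPsi_littlewood_of_RH` — under RH there is
  `c > 0` such that `ψ(u) − u ≥ c u^{1/2} log log log u` for arbitrarily large `u` and
  `ψ(u) − u ≤ −c u^{1/2} log log log u` for arbitrarily large `u` (`∃ᶠ u in atTop`), i.e.
  `ψ(x) − x = Ω±(x^{1/2} log log log x)`; the `Ω`-vocabulary of the barrier file
  `Literature/Barriers/RiemannHypothesis/LittlewoodOscillation.lean` is deliberately not imported here.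

**Proof** (as printed, MV pp. 479–480, with explicit bookkeeping). Let `N ≥ 2516` be an integer,
`T = N log N`, and apply Dirichlet's theorem (MV Lemma 15.10, the tree's
`Literature.NumberTheory.LFunctions.exists_nat_forall_abs_sub_round_lt`) to the numbers `γ (log N)/2π` for the zeros with
`|γ| ≤ T` (the finite set `SchoenfeldBound.zerosUpTo T`, of cardinality `≤ 2N(T) ≤ 2N⁺(T) ≤ N³` by the
tree's explicit Riemann–von Mangoldt bound `SchoenfeldBound.count_le_nUp`): some `n ≤ N^{N³}` has
`‖γ n log N/2π‖ < 1/N` for all of them. At `x = N^n e^{±1/N}`, `δ = 1/N`, each such zero contributes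
`±N^{-1} m(ρ)(sin(γ/N)/(γ/N))² + O(m(ρ)/γ²)` to `∑_ρ m(ρ)(sin γδ/γδ)(sin(γ log x)/γ)` (`littlewoodSum`),
since `|sin(γ log x) ∓ sin(γ/N)| ≤ 2π/N` (`abs_littlewoodTerm_sub_le`); the zeros with `|γ| ≤ N` alone give
`≥ (25/36) N^{-1} ∑_{|γ|≤N} m(ρ) = (25/18) N(N)/N ≥ (25/18)(log N/2π − 43)` (`mainSum_ge`, by
`SchoenfeldBound.nLo_le_count`), `∑ m(ρ)/γ² ≤ Kβ` (`β = ∑ m(ρ)/|ρ|²`, `nicolasBeta`), and the zeros above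
`T` contribute at most `N ∑_{|γ|>T} m(ρ)/γ² ≤ 2NK·G(T) ≤ 12K` (`SchoenfeldBound.tail_le_explicit`,
`G(T) ≤ 3 log T/T`). Hence (`littlewoodSum_bounds`) the sum is `≥ c log N − C` at `N^n e^{1/N}` and
`≤ −(c log N − C)` at `N^n e^{−1/N}` (`c = 25/(36π)`). By Lemma 15.9 the average of `ψ(u) − u` over
`[e^{−1/N}x, e^{1/N}x]` is then `≤ −x^{1/2}(c log N − C − C₉) < −(c/2)x^{1/2} log N`, resp.
`> (c/2) x^{1/2} log N`, once `(c/2) log N ≥ C + |C₉| + 1`; so some `u` in that interval has `ψ(u) − u`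
beyond `∓(c/2)x^{1/2} log N`, and there `u ≥ N/4`, `u^{1/2} ≤ 2x^{1/2}`, `log log log u ≤ 5 log N`
(`x ≤ N^{N^{N³}}e^{1/N}`; `dirichletPoint_bounds`, `logloglog_le`), giving `∓(c/20)u^{1/2} log log log u`.

## References

* [MontgomeryVaughan2007] H. L. Montgomery, R. C. Vaughan, *Multiplicative Number Theory I. Classical
  Theory*, CUP 2007, §15.2: Lemma 15.9, Lemma 15.10, Thm. 15.11 and its proof (held copy, PDF pp. 363–365).
* [Littlewood1914] J. E. Littlewood, *Sur la distribution des nombres premiers*, C. R. Acad. Sci. Paris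
  158 (1914), 1869–1872 (as cited in MV §15.3).
-/

noncomputable section

open Complex Filter Set MeasureTheory Topology
open scoped Real Chebyshev

namespace Literature.NumberTheory.LFunctions

namespace LittlewoodRH

open NicolasJExplicit SchoenfeldBound

/-! ### Elementary inequalities -/

/-- `(sin t/t)² ≥ 25/36` for `0 < |t| ≤ 1` (`sin t > t − t³/6 ≥ 5t/6` on `(0,1]`). [folklore] -/
theorem sin_div_sq_ge {t : ℝ} (ht0 : t ≠ 0) (ht1 : |t| ≤ 1) :
    (25 / 36 : ℝ) ≤ (Real.sin t / t) ^ 2 := by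
  -- reduce to `s = |t| > 0`
  have key : ∀ s : ℝ, 0 < s → s ≤ 1 → (25 / 36 : ℝ) ≤ (Real.sin s / s) ^ 2 := by
    intro s hs hs1
    have h1 : s - s ^ 3 / 6 < Real.sin s := Real.sin_gt_sub_cube hs
    have h2 : 5 / 6 * s ≤ s - s ^ 3 / 6 := by nlinarith [pow_le_one₀ hs.le hs1 (n := 2)]
    have h3 : 5 / 6 ≤ Real.sin s / s := by rw [le_div_iff₀ hs]; linarith
    nlinarith
  rcases lt_or_gt_of_ne ht0 with h | h
  · have := key (-t) (by linarith) (by rw [abs_of_neg h] at ht1; linarith)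
    rw [Real.sin_neg, neg_div_neg_eq] at this
    exact this
  · exact key t h (by rwa [abs_of_pos h] at ht1)

/-- `1 ≤ log 2π`. [folklore] -/
theorem one_le_log_two_pi : 1 ≤ Real.log (2 * π) := by
  rw [Real.le_log_iff_exp_le (by positivity)]
  have := Real.exp_one_lt_d9
  have := Real.pi_gt_three
  linarith

/-- `2 log t ≤ t` for `t > 0` (`log(t/2) ≤ t/2 − 1`, `log 2 ≤ 1`). [folklore] -/
theorem two_mul_log_le {t : ℝ} (ht : 0 < t) : 2 * Real.log t ≤ t := by
  have h3 : Real.log (t / 2) ≤ t / 2 - 1 := Real.log_le_sub_one_of_pos (by positivity)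
  rw [Real.log_div ht.ne' two_ne_zero] at h3
  have h4 : Real.log 2 ≤ 1 := by
    rw [Real.log_le_iff_le_exp two_pos]; have := Real.exp_one_gt_d9; linarith
  linarith

/-! ### The explicit zero-count bounds, simplified -/

/-- `G(t) ≤ 3 log t / t` for `t ≥ 2516` (`G = SchoenfeldBound.Gtail`). [folklore] -/
theorem Gtail_le {t : ℝ} (ht : 2516 ≤ t) : Gtail t ≤ 3 * Real.log t / t := by
  have ht0 : 0 < t := by linarith
  have hlog1 : 1 ≤ Real.log t := by
    rw [Real.le_log_iff_exp_le ht0]; have := Real.exp_one_lt_d9; linarith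
  have hl2π := one_le_log_two_pi
  unfold Gtail
  have e1 : Real.log (t / (2 * π)) = Real.log t - Real.log (2 * π) := Real.log_div ht0.ne' (by positivity)
  rw [e1]
  -- term 1 ≤ log t/(2π t) ≤ log t / t
  have hπ : 2 * π ≥ 6 := by have := Real.pi_gt_three; linarith
  have t1 : (Real.log t - Real.log (2 * π) + 1) / (2 * π) * t⁻¹ ≤ Real.log t / t := by
    rw [← div_eq_mul_inv, div_div, div_le_div_iff₀ (by positivity) ht0]
    have h1 : (Real.log t - Real.log (2 * π) + 1) * t ≤ Real.log t * t :=
      mul_le_mul_of_nonneg_right (by linarith) ht0.le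
    have h2 : Real.log t * t ≤ Real.log t * (2 * π * t) :=
      mul_le_mul_of_nonneg_left (by nlinarith) (by linarith)
    linarith
  -- term 2 ≤ log t / t
  have t2 : (2 * 34.6 + 6.67 / 2 + 2 * 6.67 * Real.log t) * (t ^ 2)⁻¹ ≤ Real.log t / t := by
    rw [← div_eq_mul_inv, div_le_div_iff₀ (by positivity) ht0]
    have : (2 * 34.6 + 6.67 / 2 + 2 * 6.67 * Real.log t) * t ≤ Real.log t * t ^ 2 := by
      have h1 : 2 * 34.6 + 6.67 / 2 + 2 * 6.67 * Real.log t ≤ Real.log t * t := by nlinarith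
      nlinarith
    linarith
  -- term 3 ≤ log t / t
  have t3 : 5 * 0.3725 / 3 * (t ^ 3)⁻¹ ≤ Real.log t / t := by
    rw [← div_eq_mul_inv, div_le_div_iff₀ (by positivity) ht0]
    have h1 : t ≤ t ^ 3 := by nlinarith
    have h2 : t ^ 3 ≤ Real.log t * t ^ 3 := by nlinarith [pow_pos ht0 3]
    nlinarith
  have : 3 * Real.log t / t = Real.log t / t + Real.log t / t + Real.log t / t := by ring
  linarith

/-- `N⁺(t) ≤ t log t` for `t ≥ 2516`. [folklore] -/
theorem nUp_le {t : ℝ} (ht : 2516 ≤ t) : nUp t ≤ t * Real.log t := by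
  have ht0 : 0 < t := by linarith
  have hlog1 : 1 ≤ Real.log t := by
    rw [Real.le_log_iff_exp_le ht0]; have := Real.exp_one_lt_d9; linarith
  have hl2π := one_le_log_two_pi
  have hπ3 := Real.pi_gt_three
  unfold nUp
  have htl : 0 ≤ t * Real.log t := by positivity
  have h1 : t * Real.log t / (2 * π) ≤ t * Real.log t / 2 := by
    rw [div_le_div_iff₀ (by positivity) two_pos]
    exact mul_le_mul_of_nonneg_left (by linarith) htl
  have h2 : -((1 + Real.log (2 * π)) * t / (2 * π)) ≤ 0 := by
    rw [neg_nonpos]; positivity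
  have h3 : 0.3725 / t ≤ 1 := by rw [div_le_one ht0]; linarith
  nlinarith

/-- `N⁻(t)/t ≥ log t/(2π) − 43` for `t ≥ 2516`. [folklore] -/
theorem nLo_div_ge {t : ℝ} (ht : 2516 ≤ t) : Real.log t / (2 * π) - 43 ≤ nLo t / t := by
  have ht0 : 0 < t := by linarith
  have hlog1 : 1 ≤ Real.log t := by
    rw [Real.le_log_iff_exp_le ht0]; have := Real.exp_one_lt_d9; linarith
  have hl2π := LittlewoodAverage.log_two_pi_le_two
  have hπ3 := Real.pi_gt_three
  have hlogt : Real.log t ≤ t := by linarith [two_mul_log_le ht0, Real.log_nonneg (by linarith : (1:ℝ) ≤ t)]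
  rw [le_div_iff₀ ht0]
  unfold nLo
  have h1 : (1 + Real.log (2 * π)) * t / (2 * π) ≤ t := by
    rw [div_le_iff₀ (by positivity)]; nlinarith
  have h2 : 0.3725 / t ≤ 1 := by rw [div_le_one ht0]; linarith
  have h3 : t * Real.log t / (2 * π) = Real.log t / (2 * π) * t := by ring
  nlinarith

/-! ### Counting identities for the finite zero sets -/

/-- No zero has `|Im ρ| ≤ 0`: `zerosUpTo 0 = ∅`. [folklore] -/
theorem zerosUpTo_zero : zerosUpTo 0 = ∅ := by
  ext ρ
  simp only [mem_zerosUpTo, Finset.notMem_empty, iff_false, not_le]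
  exact abs_pos.2 (ZetaZeros.riemannZetaNontrivialZeros.im_ne_zero ρ.2)

/-- **`∑_{|Im ρ| ≤ T} m(ρ) = 2N(T)`** (`T ≥ 0`). [cite: Titchmarsh1986, §9.1] -/
theorem sum_zeroOrder_zerosUpTo {T : ℝ} (hT : 0 ≤ T) :
    ∑ ρ ∈ zerosUpTo T, (riemannZetaZeroOrder (ρ : ℂ) : ℝ) = 2 * zetaZeroCount T := by
  have h := sum_sdiff_zerosUpTo_eq_two_mul (T₁ := 0) (T₂ := T) le_rfl
    (g := fun z ↦ (riemannZetaZeroOrder z : ℝ)) (fun z ↦ by simp [riemannZetaZeroOrder_conj_holds z])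
  rw [zerosUpTo_zero, Finset.sdiff_empty] at h
  rw [h, ← zetaZeroCount_sub_eq_sum hT, zetaZeroCount_eq_zero_of_nonpos le_rfl]
  simp

/-- `#{ρ : |Im ρ| ≤ T} ≤ 2N(T)` (each zero has multiplicity `≥ 1`). [folklore] -/
theorem card_zerosUpTo_le {T : ℝ} (hT : 0 ≤ T) : ((zerosUpTo T).card : ℝ) ≤ 2 * zetaZeroCount T := by
  rw [← sum_zeroOrder_zerosUpTo hT, Finset.card_eq_sum_ones, Nat.cast_sum]
  refine Finset.sum_le_sum fun ρ _ ↦ ?_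
  simp only [Nat.cast_one]
  exact_mod_cast ZetaZeros.riemannZetaNontrivialZeros.one_le_order ρ.2

/-! ### The main term `∑_{|γ| ≤ T} m(ρ) N sin²(γ/N)/γ²` -/

/-- The summand `m(ρ) N sin²(γ/N)/γ²` of the main term is non-negative. [folklore] -/
theorem mainSum_term_nonneg {N : ℝ} (hN : 0 ≤ N) (ρ : Zeros) :
    0 ≤ (riemannZetaZeroOrder (ρ : ℂ) : ℝ) * N * Real.sin ((ρ : ℂ).im / N) ^ 2 / (ρ : ℂ).im ^ 2 := by
  have := zeroOrder_nonneg' ρ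
  positivity

/-- **"The sum over `γ` is `≍ N log N`"** (lower bound): for `2516 ≤ N ≤ T`,
`(∑ ρ ∈ zerosUpTo T, (riemannZetaZeroOrder (ρ : ℂ) : ℝ) * N * Real.sin ((ρ : ℂ).im / N) ^ 2 / (ρ : ℂ).im ^ 2) ≥ (25/18)(log N/(2π) − 43)` — keep the zeros with `|γ| ≤ N`, where
`(sin(γ/N)/(γ/N))² ≥ 25/36`, and use `∑_{|γ| ≤ N} m(ρ) = 2N(N) ≥ 2N⁻(N)`.
[cite: MontgomeryVaughan2007, Thm. 15.11 (proof)] -/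
theorem mainSum_ge {N T : ℝ} (hN : 2516 ≤ N) (hNT : N ≤ T) :
    25 / 18 * (Real.log N / (2 * π) - 43) ≤ (∑ ρ ∈ zerosUpTo T, (riemannZetaZeroOrder (ρ : ℂ) : ℝ) * N * Real.sin ((ρ : ℂ).im / N) ^ 2 / (ρ : ℂ).im ^ 2) := by
  have hN0 : 0 < N := by linarith
  have h1 : (∑ ρ ∈ zerosUpTo N, (riemannZetaZeroOrder (ρ : ℂ) : ℝ) * N * Real.sin ((ρ : ℂ).im / N) ^ 2 / (ρ : ℂ).im ^ 2) ≤ (∑ ρ ∈ zerosUpTo T, (riemannZetaZeroOrder (ρ : ℂ) : ℝ) * N * Real.sin ((ρ : ℂ).im / N) ^ 2 / (ρ : ℂ).im ^ 2) :=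
    Finset.sum_le_sum_of_subset_of_nonneg (zerosUpTo_subset hNT) fun ρ _ _ ↦ mainSum_term_nonneg hN0.le ρ
  have h2 : ∑ ρ ∈ zerosUpTo N, (riemannZetaZeroOrder (ρ : ℂ) : ℝ) * (25 / 36 / N) ≤ (∑ ρ ∈ zerosUpTo N, (riemannZetaZeroOrder (ρ : ℂ) : ℝ) * N * Real.sin ((ρ : ℂ).im / N) ^ 2 / (ρ : ℂ).im ^ 2) := by
    refine Finset.sum_le_sum fun ρ hρ ↦ ?_
    have hm := zeroOrder_nonneg' ρ
    have hγT : |(ρ : ℂ).im| ≤ N := mem_zerosUpTo.1 hρ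
    have hγ0 : (ρ : ℂ).im ≠ 0 := ZetaZeros.riemannZetaNontrivialZeros.im_ne_zero ρ.2
    set t : ℝ := (ρ : ℂ).im / N with ht
    have ht0 : t ≠ 0 := div_ne_zero hγ0 hN0.ne'
    have ht1 : |t| ≤ 1 := by rw [ht, abs_div, abs_of_pos hN0, div_le_one hN0]; exact hγT
    have key := sin_div_sq_ge ht0 ht1
    have e : (riemannZetaZeroOrder (ρ : ℂ) : ℝ) * N * Real.sin ((ρ : ℂ).im / N) ^ 2 / (ρ : ℂ).im ^ 2 =
        (riemannZetaZeroOrder (ρ : ℂ) : ℝ) * ((Real.sin t / t) ^ 2 / N) := by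
      rw [ht]; field_simp
    rw [e]
    refine mul_le_mul_of_nonneg_left ?_ hm
    rw [div_le_div_iff_of_pos_right hN0]
    exact key
  have h3 : ∑ ρ ∈ zerosUpTo N, (riemannZetaZeroOrder (ρ : ℂ) : ℝ) * (25 / 36 / N) =
      25 / 18 * (zetaZeroCount N / N) := by
    rw [← Finset.sum_mul, sum_zeroOrder_zerosUpTo hN0.le]; field_simp; ring
  have h4 : Real.log N / (2 * π) - 43 ≤ zetaZeroCount N / N :=
    (nLo_div_ge hN).trans (div_le_div_of_nonneg_right (nLo_le_count hN) hN0.le)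
  linarith

/-! ### The Littlewood sum at the Dirichlet points -/

/-- **One aligned zero.** If `‖(γ log N/2π) n‖ < 1/N` (distance to the nearest integer) and
`x = N^n e^{ε/N}`, `ε = ±1`, then
`|m(sin(γ/N)/(γ/N))(sin(γ log x)/γ) − ε m N sin²(γ/N)/γ²| ≤ 2π m/γ²`
("`|sin(γ log x) ∓ sin γ/N| ≤ 2π/N`", MV p. 479). [cite: MontgomeryVaughan2007, Thm. 15.11 (proof)] -/
theorem abs_littlewoodTerm_sub_le {N : ℕ} (hN : 0 < N) (n : ℕ) {ε : ℝ} (hε : ε = 1 ∨ ε = -1) {ρ : ℂ}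
    (hm : 0 ≤ (riemannZetaZeroOrder ρ : ℝ))
    (hround : |ρ.im * Real.log N / (2 * π) * n - round (ρ.im * Real.log N / (2 * π) * n)| < 1 / N) :
    |littlewoodTerm (1 / N) (Real.exp (n * Real.log N + ε / N)) ρ -
        ε * ((riemannZetaZeroOrder ρ : ℝ) * N * Real.sin (ρ.im / N) ^ 2 / ρ.im ^ 2)| ≤
      2 * π * (riemannZetaZeroOrder ρ : ℝ) / ρ.im ^ 2 := by
  set γ : ℝ := ρ.im with hγ
  set m : ℝ := (riemannZetaZeroOrder ρ : ℝ) with hmdef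
  have hN' : (0 : ℝ) < N := by exact_mod_cast hN
  rcases eq_or_ne γ 0 with h0 | hγ0
  · simp [littlewoodTerm, ← hγ, h0]
  set α : ℝ := γ * Real.log N / (2 * π) with hα
  set k : ℤ := round (α * n) with hk
  have hlogx : Real.log (Real.exp (n * Real.log N + ε / N)) = n * Real.log N + ε / N := Real.log_exp _
  -- the phase
  have hphase : γ * (n * Real.log N + ε / N) = (2 * π * (α * n - k) + ε * γ / N) + k * (2 * π) := by
    rw [hα]; field_simp; ring
  have hsin : |Real.sin (γ * (n * Real.log N + ε / N)) - ε * Real.sin (γ / N)| ≤ 2 * π / N := by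
    rw [hphase, Real.sin_add_int_mul_two_pi]
    have hεsin : ε * Real.sin (γ / N) = Real.sin (ε * γ / N) := by
      rcases hε with rfl | rfl
      · simp
      · rw [show (-1 : ℝ) * γ / N = -(γ / N) by ring, Real.sin_neg]; ring
    rw [hεsin]
    refine (Real.abs_sin_sub_sin_le _ _).trans ?_
    rw [show 2 * π * (α * n - k) + ε * γ / N - ε * γ / N = 2 * π * (α * n - k) by ring, abs_mul,
      abs_of_pos (by positivity : (0:ℝ) < 2 * π)]
    rw [hk] at *
    have := hround
    calc 2 * π * |α * n - round (α * n)| ≤ 2 * π * (1 / N) := by gcongr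
      _ = 2 * π / N := by ring
  -- the algebra
  have e : littlewoodTerm (1 / N) (Real.exp (n * Real.log N + ε / N)) ρ -
      ε * (m * N * Real.sin (γ / N) ^ 2 / γ ^ 2) =
      m * N * Real.sin (γ / N) * (Real.sin (γ * (n * Real.log N + ε / N)) - ε * Real.sin (γ / N)) / γ ^ 2 := by
    rw [littlewoodTerm, hlogx, ← hγ, ← hmdef, show γ * (1 / (N : ℝ)) = γ / N by ring]
    field_simp
  rw [e, abs_div, abs_mul, abs_mul, abs_mul, abs_of_nonneg hm, abs_of_pos hN',
    abs_of_pos (by positivity : (0:ℝ) < γ ^ 2)]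
  refine div_le_div_of_nonneg_right ?_ (by positivity)
  have hs1 : |Real.sin (γ / N)| ≤ 1 := Real.abs_sin_le_one _
  calc m * N * |Real.sin (γ / N)| * |Real.sin (γ * (n * Real.log N + ε / N)) - ε * Real.sin (γ / N)|
      ≤ m * N * 1 * (2 * π / N) := by gcongr
    _ = 2 * π * m := by field_simp

/-- The tail of `∑ m(ρ)/|ρ|²` above height `T`, as a sum over the complementary subtype (under RH).
[cite: Nicolas2012, (1.3)] -/
theorem tsum_compl_zeroOrder_div_norm_sq (hRH : RiemannHypothesis) (T : ℝ) :
    ∑' ρ : (((zerosUpTo T : Finset Zeros) : Set Zeros)ᶜ : Set Zeros),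
        (riemannZetaZeroOrder ((ρ : Zeros) : ℂ) : ℝ) / ‖((ρ : Zeros) : ℂ)‖ ^ 2 =
      nicolasBeta - sumInvNormSq T := by
  rw [tsum_subtype (((zerosUpTo T : Finset Zeros) : Set Zeros)ᶜ)
    (fun ρ : Zeros ↦ (riemannZetaZeroOrder (ρ : ℂ) : ℝ) / ‖(ρ : ℂ)‖ ^ 2)]
  have hfun : (((zerosUpTo T : Finset Zeros) : Set Zeros)ᶜ).indicator
      (fun ρ : Zeros ↦ (riemannZetaZeroOrder (ρ : ℂ) : ℝ) / ‖(ρ : ℂ)‖ ^ 2) =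
      fun ρ ↦ if ρ ∈ zerosUpTo T then 0 else (riemannZetaZeroOrder (ρ : ℂ) : ℝ) / ‖(ρ : ℂ)‖ ^ 2 := by
    funext ρ
    by_cases h : ρ ∈ zerosUpTo T
    · rw [Set.indicator_of_notMem (by simpa using h), if_pos h]
    · rw [Set.indicator_of_mem (by simpa using h), if_neg h]
  rw [hfun]
  exact (hasSum_tail_of_RH hRH T).tsum_eq

/-- **The Littlewood sum at the two Dirichlet points** (heart of MV's proof of Thm. 15.11 under RH):
there are `c > 0` and `C` such that for every integer `N ≥ 2516` there is `n`, `1 ≤ n ≤ N^{N³}`, with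
`∑_ρ m(ρ)(sin(γ/N)/(γ/N))(sin(γ log x)/γ) ≥ c log N − C` at `x = N^n e^{1/N}` and `≤ −(c log N − C)` at
`x = N^n e^{−1/N}`: Dirichlet's theorem (Lemma 15.10) aligns `‖γ n log N/2π‖ < 1/N` for the zeros with
`|γ| ≤ T = N log N` (at most `2N(T) ≤ N³` of them), which then contribute
`± N^{-1}∑ m (sin(γ/N)/(γ/N))² + O(∑ m/γ²)`, of size `≫ N(N)/N ≫ log N`; the zeros above `T`
contribute `≤ N ∑_{|γ|>T} m/γ² ≪ N log T/T ≪ 1`. [cite: MontgomeryVaughan2007, Thm. 15.11 (proof)] -/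
theorem littlewoodSum_bounds (hRH : RiemannHypothesis) :
    ∃ c : ℝ, 0 < c ∧ ∃ C : ℝ, ∀ N : ℕ, 2516 ≤ N →
      ∃ n : ℕ, 1 ≤ n ∧ n ≤ N ^ (N ^ 3) ∧
        c * Real.log N - C ≤ littlewoodSum (1 / N) (Real.exp (n * Real.log N + 1 / N)) ∧
        littlewoodSum (1 / N) (Real.exp (n * Real.log N + (-1) / N)) ≤ -(c * Real.log N - C) := by
  obtain ⟨δ₀, hδ₀, -, hgap⟩ := ZetaZeroSum.exists_gap_im
  set g₀ : ℝ := 2 * δ₀ with hg₀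
  have hg₀pos : 0 < g₀ := by positivity
  set K : ℝ := 1 + 1 / (4 * g₀ ^ 2) with hK
  have hK1 : 1 ≤ K := by
    have : 0 ≤ 1 / (4 * g₀ ^ 2) := by positivity
    rw [hK]; linarith
  have hK0 : 0 ≤ K := by linarith
  have hKρ : ∀ ρ : Zeros, (riemannZetaZeroOrder (ρ : ℂ) : ℝ) / (ρ : ℂ).im ^ 2 ≤
      K * ((riemannZetaZeroOrder (ρ : ℂ) : ℝ) / ‖(ρ : ℂ)‖ ^ 2) := by
    intro ρ
    have hm := zeroOrder_nonneg' ρ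
    have hγ : g₀ ≤ |(ρ : ℂ).im| := hgap _ ρ.2
    have hγ2 : g₀ ^ 2 ≤ (ρ : ℂ).im ^ 2 := by
      rw [← sq_abs (ρ : ℂ).im]; exact pow_le_pow_left₀ hg₀pos.le hγ 2
    have hγpos : 0 < (ρ : ℂ).im ^ 2 := lt_of_lt_of_le (by positivity) hγ2
    rw [norm_sq_eq_of_RH hRH ρ, ← mul_div_assoc, div_le_div_iff₀ hγpos (by positivity)]
    have h1 : (1 / 4 + (ρ : ℂ).im ^ 2) ≤ K * (ρ : ℂ).im ^ 2 := by
      have h2 : (1 / 4 : ℝ) ≤ 1 / (4 * g₀ ^ 2) * (ρ : ℂ).im ^ 2 := by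
        rw [div_mul_eq_mul_div, le_div_iff₀ (by positivity)]
        nlinarith
      rw [hK, add_mul, one_mul]
      linarith
    calc (riemannZetaZeroOrder (ρ : ℂ) : ℝ) * (1 / 4 + (ρ : ℂ).im ^ 2)
        ≤ (riemannZetaZeroOrder (ρ : ℂ) : ℝ) * (K * (ρ : ℂ).im ^ 2) := mul_le_mul_of_nonneg_left h1 hm
      _ = K * (riemannZetaZeroOrder (ρ : ℂ) : ℝ) * (ρ : ℂ).im ^ 2 := by ring
  set β : ℝ := nicolasBeta with hβ
  have hβsum := hasSum_zeroOrder_div_norm_sq_of_RH hRH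
  have hβ0 : 0 ≤ β :=
    hβsum.nonneg fun ρ ↦ div_nonneg (zeroOrder_nonneg' ρ) (sq_nonneg _)
  refine ⟨25 / (36 * π), by positivity, 25 / 18 * 43 + (2 * π * (K * β) + 12 * K), fun N hN ↦ ?_⟩
  have hNpos : 0 < N := by omega
  have hN' : (2516 : ℝ) ≤ N := by exact_mod_cast hN
  have hN0 : (0 : ℝ) < N := by linarith
  have hlogN1 : 1 ≤ Real.log N := by
    rw [Real.le_log_iff_exp_le hN0]; have := Real.exp_one_lt_d9; linarith
  have hlogN0 : 0 < Real.log N := by linarith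
  have hlogN : 2 * Real.log N ≤ N := two_mul_log_le hN0
  set T : ℝ := N * Real.log N with hT
  have hNT : (N : ℝ) ≤ T := by rw [hT]; nlinarith
  have hT' : 2516 ≤ T := hN'.trans hNT
  have hT0 : 0 < T := by linarith
  have hlogT : Real.log T ≤ 2 * Real.log N := by
    rw [hT, Real.log_mul hN0.ne' hlogN0.ne']
    have : Real.log (Real.log N) ≤ Real.log N := by
      have := Real.log_le_sub_one_of_pos hlogN0; linarith
    linarith
  have hlogT0 : 0 < Real.log T := Real.log_pos (by linarith)
  set F : Finset Zeros := zerosUpTo T with hF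
  -- Dirichlet
  obtain ⟨n, hn0, hnle, hround⟩ := exists_nat_forall_abs_sub_round_lt (ι := ↥F)
    (fun ρ ↦ ((ρ : Zeros) : ℂ).im * Real.log N / (2 * π)) hNpos
  -- at most `N³` zeros are aligned
  have hcard : F.card ≤ N ^ 3 := by
    have h1 : (F.card : ℝ) ≤ 2 * zetaZeroCount T := card_zerosUpTo_le hT0.le
    have h2 : (zetaZeroCount T : ℝ) ≤ T * Real.log T := (count_le_nUp hT').trans (nUp_le hT')
    have h3 : T * Real.log T ≤ 2 * N * Real.log N ^ 2 := by
      rw [hT]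
      have := mul_le_mul_of_nonneg_left hlogT (by positivity : (0 : ℝ) ≤ N * Real.log N)
      nlinarith
    have h4 : 2 * (2 * N * Real.log N ^ 2) ≤ (N : ℝ) ^ 3 := by
      have e : 2 * (2 * (N : ℝ) * Real.log N ^ 2) = N * ((2 * Real.log N) * (2 * Real.log N)) := by ring
      have e3 : (N : ℝ) ^ 3 = N * (N * N) := by ring
      rw [e, e3]
      refine mul_le_mul_of_nonneg_left ?_ hN0.le
      exact mul_le_mul hlogN hlogN (by positivity) hN0.le
    have : (F.card : ℝ) ≤ (N : ℝ) ^ 3 := by linarith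
    exact_mod_cast this
  have hnN : n ≤ N ^ (N ^ 3) :=
    hnle.trans (by rw [Fintype.card_coe]; exact Nat.pow_le_pow_right hNpos hcard)
  refine ⟨n, hn0, hnN, ?_⟩
  -- the three estimates
  have hmain : 25 / 18 * (Real.log N / (2 * π) - 43) ≤ (∑ ρ ∈ zerosUpTo T, (riemannZetaZeroOrder (ρ : ℂ) : ℝ) * N * Real.sin ((ρ : ℂ).im / N) ^ 2 / (ρ : ℂ).im ^ 2) := mainSum_ge hN' hNT
  have htail : (N : ℝ) * K * (β - sumInvNormSq T) ≤ 12 * K := by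
    have h1 : β - sumInvNormSq T ≤ 2 * Gtail T := tail_le_explicit hRH hT'
    have h2 : Gtail T ≤ 3 * Real.log T / T := Gtail_le hT'
    have h3 : (N : ℝ) * (3 * Real.log T / T) ≤ 6 := by
      rw [hT, mul_div_assoc', div_le_iff₀ (by positivity)]
      have := mul_le_mul_of_nonneg_left hlogT (by positivity : (0 : ℝ) ≤ 3 * N)
      nlinarith
    have h4 : β - sumInvNormSq T ≤ 2 * (3 * Real.log T / T) := by linarith
    calc (N : ℝ) * K * (β - sumInvNormSq T) ≤ (N : ℝ) * K * (2 * (3 * Real.log T / T)) :=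
          mul_le_mul_of_nonneg_left h4 (by positivity)
      _ = 2 * K * ((N : ℝ) * (3 * Real.log T / T)) := by ring
      _ ≤ 2 * K * 6 := mul_le_mul_of_nonneg_left h3 (by positivity)
      _ = 12 * K := by ring
  have hfin : ∑ ρ ∈ F, (riemannZetaZeroOrder (ρ : ℂ) : ℝ) / (ρ : ℂ).im ^ 2 ≤ K * β := by
    calc ∑ ρ ∈ F, (riemannZetaZeroOrder (ρ : ℂ) : ℝ) / (ρ : ℂ).im ^ 2
        ≤ ∑ ρ ∈ F, K * ((riemannZetaZeroOrder (ρ : ℂ) : ℝ) / ‖(ρ : ℂ)‖ ^ 2) :=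
          Finset.sum_le_sum fun ρ _ ↦ hKρ ρ
      _ = K * sumInvNormSq T := by rw [← Finset.mul_sum]; rfl
      _ ≤ K * β := mul_le_mul_of_nonneg_left (sumInvNormSq_le_nicolasBeta hRH T) hK0
  -- the sum at `x = N^n e^{ε/N}`
  have key : ∀ ε : ℝ, ε = 1 ∨ ε = -1 →
      |littlewoodSum (1 / N) (Real.exp (n * Real.log N + ε / N)) - ε * (∑ ρ ∈ zerosUpTo T, (riemannZetaZeroOrder (ρ : ℂ) : ℝ) * N * Real.sin ((ρ : ℂ).im / N) ^ 2 / (ρ : ℂ).im ^ 2)| ≤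
        2 * π * (K * β) + 12 * K := by
    intro ε hε
    set x : ℝ := Real.exp (n * Real.log N + ε / N) with hx
    have hsplit := (summable_littlewoodTerm (1 / N) x).sum_add_tsum_compl (s := F)
    -- aligned zeros
    have hFbd : |∑ ρ ∈ F, littlewoodTerm (1 / N) x ρ - ε * (∑ ρ ∈ zerosUpTo T, (riemannZetaZeroOrder (ρ : ℂ) : ℝ) * N * Real.sin ((ρ : ℂ).im / N) ^ 2 / (ρ : ℂ).im ^ 2)| ≤ 2 * π * (K * β) := by
      rw [Finset.mul_sum, ← Finset.sum_sub_distrib]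
      refine (Finset.abs_sum_le_sum_abs _ _).trans ?_
      calc ∑ ρ ∈ F, |littlewoodTerm (1 / N) x ρ -
            ε * ((riemannZetaZeroOrder (ρ : ℂ) : ℝ) * N * Real.sin ((ρ : ℂ).im / N) ^ 2 / (ρ : ℂ).im ^ 2)|
          ≤ ∑ ρ ∈ F, 2 * π * (riemannZetaZeroOrder (ρ : ℂ) : ℝ) / (ρ : ℂ).im ^ 2 :=
            Finset.sum_le_sum fun ρ hρ ↦
              abs_littlewoodTerm_sub_le hNpos n hε (zeroOrder_nonneg' ρ) (hround ⟨ρ, hρ⟩)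
        _ = 2 * π * ∑ ρ ∈ F, (riemannZetaZeroOrder (ρ : ℂ) : ℝ) / (ρ : ℂ).im ^ 2 := by
            rw [Finset.mul_sum]; refine Finset.sum_congr rfl fun ρ _ ↦ ?_; ring
        _ ≤ 2 * π * (K * β) := mul_le_mul_of_nonneg_left hfin (by positivity)
    -- the zeros above `T`
    have hCbd : |∑' ρ : (((F : Finset Zeros) : Set Zeros)ᶜ : Set Zeros), littlewoodTerm (1 / N) x ρ| ≤
        12 * K := by
      have h1 : Summable fun ρ : (((F : Finset Zeros) : Set Zeros)ᶜ : Set Zeros) ↦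
          littlewoodTerm (1 / N) x ρ := (summable_littlewoodTerm (1 / N) x).subtype _
      have h3 : Summable fun ρ : (((F : Finset Zeros) : Set Zeros)ᶜ : Set Zeros) ↦
          (N : ℝ) * K * ((riemannZetaZeroOrder ((ρ : Zeros) : ℂ) : ℝ) / ‖((ρ : Zeros) : ℂ)‖ ^ 2) :=
        (hβsum.summable.subtype _).mul_left _
      have h2 : ∀ ρ : (((F : Finset Zeros) : Set Zeros)ᶜ : Set Zeros), |littlewoodTerm (1 / N) x ρ| ≤
          (N : ℝ) * K * ((riemannZetaZeroOrder ((ρ : Zeros) : ℂ) : ℝ) / ‖((ρ : Zeros) : ℂ)‖ ^ 2) := by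
        intro ρ
        have hm := zeroOrder_nonneg' (ρ : Zeros)
        have hb := abs_littlewoodTerm_le (δ := 1 / N) (by positivity) x hm
        rw [abs_of_pos (by positivity : (0 : ℝ) < 1 / N)] at hb
        refine hb.trans ?_
        have e : (riemannZetaZeroOrder ((ρ : Zeros) : ℂ) : ℝ) / (1 / N * ((ρ : Zeros) : ℂ).im ^ 2) =
            N * ((riemannZetaZeroOrder ((ρ : Zeros) : ℂ) : ℝ) / ((ρ : Zeros) : ℂ).im ^ 2) := by
          field_simp
        rw [e, mul_assoc]
        exact mul_le_mul_of_nonneg_left (hKρ _) hN0.le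
      calc |∑' ρ : (((F : Finset Zeros) : Set Zeros)ᶜ : Set Zeros), littlewoodTerm (1 / N) x ρ|
          ≤ ∑' ρ : (((F : Finset Zeros) : Set Zeros)ᶜ : Set Zeros), |littlewoodTerm (1 / N) x ρ| := by
            have := norm_tsum_le_tsum_norm h1.norm
            simpa only [Real.norm_eq_abs] using this
        _ ≤ ∑' ρ : (((F : Finset Zeros) : Set Zeros)ᶜ : Set Zeros),
              (N : ℝ) * K * ((riemannZetaZeroOrder ((ρ : Zeros) : ℂ) : ℝ) / ‖((ρ : Zeros) : ℂ)‖ ^ 2) :=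
            h1.abs.tsum_le_tsum h2 h3
        _ = (N : ℝ) * K * (β - sumInvNormSq T) := by
            rw [tsum_mul_left, tsum_compl_zeroOrder_div_norm_sq hRH T]
        _ ≤ 12 * K := htail
    -- combine
    rw [littlewoodSum, ← hsplit]
    have e : ∑ ρ ∈ F, littlewoodTerm (1 / N) x ρ +
        ∑' ρ : (((F : Finset Zeros) : Set Zeros)ᶜ : Set Zeros), littlewoodTerm (1 / N) x ρ - ε * (∑ ρ ∈ zerosUpTo T, (riemannZetaZeroOrder (ρ : ℂ) : ℝ) * N * Real.sin ((ρ : ℂ).im / N) ^ 2 / (ρ : ℂ).im ^ 2) =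
        (∑ ρ ∈ F, littlewoodTerm (1 / N) x ρ - ε * (∑ ρ ∈ zerosUpTo T, (riemannZetaZeroOrder (ρ : ℂ) : ℝ) * N * Real.sin ((ρ : ℂ).im / N) ^ 2 / (ρ : ℂ).im ^ 2)) +
          ∑' ρ : (((F : Finset Zeros) : Set Zeros)ᶜ : Set Zeros), littlewoodTerm (1 / N) x ρ := by ring
    rw [e]
    exact (abs_add_le _ _).trans (add_le_add hFbd hCbd)
  have e43 : 25 / (36 * π) * Real.log N - (25 / 18 * 43 + (2 * π * (K * β) + 12 * K)) =
      25 / 18 * (Real.log N / (2 * π) - 43) - (2 * π * (K * β) + 12 * K) := by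
    field_simp; ring
  constructor
  · have h := key 1 (Or.inl rfl)
    rw [one_mul] at h
    have h' := abs_le.1 h
    rw [e43]; linarith [h'.1]
  · have h := key (-1) (Or.inr rfl)
    have h' := abs_le.1 h
    rw [e43]; linarith [h'.2]

/-! ### From an average to a point, and the size of `log log log` -/

/-- If the average of `f` over `[a, b]` is `< −A`, then `f(u) < −A` somewhere on `[a, b]`. [folklore] -/
theorem exists_lt_of_average_lt {f : ℝ → ℝ} {a b A : ℝ} (hab : a < b)
    (hf : IntervalIntegrable f volume a b) (h : (∫ u in a..b, f u) / (b - a) < -A) :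
    ∃ u ∈ Icc a b, f u < -A := by
  by_contra hcon
  push Not at hcon
  have hint : ∫ _ in a..b, -A ≤ ∫ u in a..b, f u :=
    intervalIntegral.integral_mono_on hab.le (by simp) hf fun u hu ↦ hcon u hu
  rw [intervalIntegral.integral_const, smul_eq_mul] at hint
  rw [div_lt_iff₀ (by linarith)] at h
  linarith

/-- If the average of `f` over `[a, b]` is `> A`, then `f(u) > A` somewhere on `[a, b]`. [folklore] -/
theorem exists_gt_of_lt_average {f : ℝ → ℝ} {a b A : ℝ} (hab : a < b)
    (hf : IntervalIntegrable f volume a b) (h : A < (∫ u in a..b, f u) / (b - a)) :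
    ∃ u ∈ Icc a b, A < f u := by
  by_contra hcon
  push Not at hcon
  have hint : ∫ u in a..b, f u ≤ ∫ _ in a..b, A :=
    intervalIntegral.integral_mono_on hab.le hf (by simp) fun u hu ↦ hcon u hu
  rw [intervalIntegral.integral_const, smul_eq_mul] at hint
  rw [lt_div_iff₀ (by linarith)] at h
  linarith

/-- **`log N ≥ (1+o(1)) log log log x`**, crude form: if `N ≥ 3`, `u ≥ 3` and
`log u ≤ N^{N³} log N + 2`, then `log log log u ≤ 5 log N`. [cite: MontgomeryVaughan2007, Thm. 15.11 (proof)] -/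
theorem logloglog_le {N : ℕ} (hN : 3 ≤ N) {u : ℝ} (hu : 3 ≤ u)
    (hlogu : Real.log u ≤ (N : ℝ) ^ (N ^ 3) * Real.log N + 2) :
    Real.log (Real.log (Real.log u)) ≤ 5 * Real.log N := by
  have hN' : (3 : ℝ) ≤ N := by exact_mod_cast hN
  have hN0 : (0 : ℝ) < N := by linarith
  have hlogN : Real.log N ≤ N := by linarith [two_mul_log_le hN0, Real.log_nonneg (by linarith : (1:ℝ) ≤ N)]
  have hlog3 : 1 < Real.log 3 := by
    rw [Real.lt_log_iff_exp_lt (by norm_num)]; have := Real.exp_one_lt_d9; linarith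
  have hlogu1 : 1 < Real.log u := hlog3.trans_le (Real.log_le_log (by norm_num) hu)
  have hllu : 0 < Real.log (Real.log u) := Real.log_pos hlogu1
  have hP0 : 0 < (N : ℝ) ^ (N ^ 3) := by positivity
  have hB1 : 1 < (N : ℝ) ^ (N ^ 3) * Real.log N + 2 := by
    have : 0 ≤ (N : ℝ) ^ (N ^ 3) * Real.log N := by positivity
    linarith
  have hBle : (N : ℝ) ^ (N ^ 3) * Real.log N + 2 ≤ 2 * ((N : ℝ) ^ (N ^ 3) * N) := by
    have h1 : (N : ℝ) ^ (N ^ 3) * Real.log N ≤ (N : ℝ) ^ (N ^ 3) * N :=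
      mul_le_mul_of_nonneg_left hlogN hP0.le
    have h2 : (N : ℝ) ≤ (N : ℝ) ^ (N ^ 3) := le_self_pow₀ (by linarith) (pow_ne_zero 3 (by omega))
    nlinarith
  have hlogB : Real.log ((N : ℝ) ^ (N ^ 3) * Real.log N + 2) ≤ 3 * (N : ℝ) ^ 4 := by
    have h1 : Real.log ((N : ℝ) ^ (N ^ 3) * Real.log N + 2) ≤ Real.log (2 * ((N : ℝ) ^ (N ^ 3) * N)) :=
      Real.log_le_log (by linarith) hBle
    have h2 : Real.log (2 * ((N : ℝ) ^ (N ^ 3) * N)) =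
        Real.log 2 + ((N ^ 3 : ℕ) : ℝ) * Real.log N + Real.log N := by
      rw [Real.log_mul (by norm_num) (by positivity), Real.log_mul (by positivity) hN0.ne', Real.log_pow]
      ring
    have h3 : Real.log 2 ≤ 1 := by
      rw [Real.log_le_iff_le_exp two_pos]; have := Real.exp_one_gt_d9; linarith
    have h4 : ((N ^ 3 : ℕ) : ℝ) * Real.log N + Real.log N ≤ ((N : ℝ) ^ 3 + 1) * N := by
      push_cast
      have : ((N : ℝ) ^ 3 + 1) * Real.log N ≤ ((N : ℝ) ^ 3 + 1) * N :=
        mul_le_mul_of_nonneg_left hlogN (by positivity)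
      linarith
    have h5 : (1 : ℝ) ≤ (N : ℝ) ^ 4 := one_le_pow₀ (by linarith)
    have h6 : (N : ℝ) ≤ (N : ℝ) ^ 4 := le_self_pow₀ (by linarith) (by norm_num)
    have e : ((N : ℝ) ^ 3 + 1) * N = (N : ℝ) ^ 4 + N := by ring
    linarith
  have hlogB0 : 0 < Real.log ((N : ℝ) ^ (N ^ 3) * Real.log N + 2) := Real.log_pos hB1
  have hllB : Real.log (Real.log ((N : ℝ) ^ (N ^ 3) * Real.log N + 2)) ≤ 5 * Real.log N := by
    have h1 := Real.log_le_log hlogB0 hlogB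
    have h2 : Real.log (3 * (N : ℝ) ^ 4) = Real.log 3 + 4 * Real.log N := by
      rw [Real.log_mul (by norm_num) (by positivity), Real.log_pow]; push_cast; ring
    have h3 : Real.log 3 ≤ Real.log N := Real.log_le_log (by norm_num) hN'
    linarith
  have h1 : Real.log (Real.log u) ≤ Real.log ((N : ℝ) ^ (N ^ 3) * Real.log N + 2) :=
    Real.log_le_log (by linarith) hlogu
  have h2 := Real.log_le_log hllu h1
  linarith

/-- **Bookkeeping at a Dirichlet point.** For `N ≥ 2516`, `1 ≤ n ≤ N^{N³}`, `ε = ±1` and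
`x = N^n e^{ε/N}`: `x ≥ N/2`, `1/(2x) ≤ 1/N`, and every `u ∈ [e^{−1/N}x, e^{1/N}x]` has `u ≥ N/4`,
`u^{1/2} ≤ 2x^{1/2}` and `log log log u ≤ 5 log N`. [cite: MontgomeryVaughan2007, Thm. 15.11 (proof)] -/
theorem dirichletPoint_bounds {N n : ℕ} (hN : 2516 ≤ N) (hn1 : 1 ≤ n) (hnN : n ≤ N ^ (N ^ 3)) {ε : ℝ}
    (hε : ε = 1 ∨ ε = -1) {x : ℝ} (hx : x = Real.exp (n * Real.log N + ε / N)) :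
    (N : ℝ) / 2 ≤ x ∧ 1 / (2 * x) ≤ 1 / N ∧
      ∀ u ∈ Icc (Real.exp (-(1 / N)) * x) (Real.exp (1 / N) * x),
        (N : ℝ) / 4 ≤ u ∧ u ^ (1 / 2 : ℝ) ≤ 2 * x ^ (1 / 2 : ℝ) ∧
          Real.log (Real.log (Real.log u)) ≤ 5 * Real.log N := by
  have hN3 : 3 ≤ N := by omega
  have hN' : (2516 : ℝ) ≤ N := by exact_mod_cast hN
  have hN0 : (0 : ℝ) < N := by linarith
  have hlogN1 : 1 ≤ Real.log N := by
    rw [Real.le_log_iff_exp_le hN0]; have := Real.exp_one_lt_d9; linarith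
  have hn1' : (1 : ℝ) ≤ n := by exact_mod_cast hn1
  have hnN' : (n : ℝ) ≤ (N : ℝ) ^ (N ^ 3) := by exact_mod_cast hnN
  have heN : 1 - 1 / (N : ℝ) ≤ Real.exp (-(1 / N)) := by
    have := Real.add_one_le_exp (-(1 / (N : ℝ))); linarith
  have hxlow : (N : ℝ) / 2 ≤ x := by
    have h1 : Real.log N - 1 / 2 ≤ n * Real.log N + ε / N := by
      have : Real.log N ≤ n * Real.log N := by nlinarith
      have : -(1 / 2 : ℝ) ≤ ε / N := by
        rw [le_div_iff₀ hN0]; rcases hε with rfl | rfl <;> nlinarith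
      linarith
    have h2 : Real.exp (Real.log N - 1 / 2) ≤ x := by rw [hx]; exact Real.exp_le_exp.2 h1
    rw [Real.exp_sub, Real.exp_log hN0] at h2
    have h3 : Real.exp (1 / 2 : ℝ) ≤ 2 := by
      have h4 : Real.exp (1 / 2 : ℝ) ^ 2 = Real.exp 1 := by rw [← Real.exp_nat_mul]; norm_num
      nlinarith [Real.exp_pos (1 / 2 : ℝ), Real.exp_one_lt_d9]
    calc (N : ℝ) / 2 ≤ N / Real.exp (1 / 2) := by
          rw [div_le_div_iff₀ two_pos (Real.exp_pos _)]; nlinarith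
      _ ≤ x := h2
  have hx0 : 0 < x := by linarith
  refine ⟨hxlow, ?_, fun u hu ↦ ?_⟩
  · rw [div_le_div_iff₀ (by positivity) hN0]; linarith
  obtain ⟨hu1, hu2⟩ := hu
  have hulow : (N : ℝ) / 4 ≤ u := by
    have h1 : (1 - 1 / (N : ℝ)) * x ≤ u := le_trans (mul_le_mul_of_nonneg_right heN hx0.le) hu1
    have h2 : (1 / 2 : ℝ) ≤ 1 - 1 / N := by
      have : 1 / (N : ℝ) ≤ 1 / 2 := by rw [div_le_div_iff₀ hN0 two_pos]; linarith
      linarith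
    nlinarith
  have hu3 : 3 ≤ u := by linarith
  have heN' : Real.exp (1 / (N : ℝ)) ≤ 3 := by
    have h1 : Real.exp (1 / (N : ℝ)) ≤ Real.exp 1 :=
      Real.exp_le_exp.2 (by rw [div_le_one hN0]; linarith)
    have := Real.exp_one_lt_d9; linarith
  refine ⟨hulow, ?_, ?_⟩
  · have h1 : u ≤ 4 * x := by nlinarith
    calc u ^ (1 / 2 : ℝ) ≤ (4 * x) ^ (1 / 2 : ℝ) := Real.rpow_le_rpow (by linarith) h1 (by norm_num)
      _ = 2 * x ^ (1 / 2 : ℝ) := by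
          rw [Real.mul_rpow (by norm_num) hx0.le, show (4 : ℝ) = 2 ^ (2 : ℝ) by norm_num,
            ← Real.rpow_mul (by norm_num)]
          norm_num
  · refine logloglog_le hN3 hu3 ?_
    have h1 : Real.log u ≤ Real.log (Real.exp (1 / N) * x) := Real.log_le_log (by linarith) hu2
    rw [hx, Real.log_mul (Real.exp_pos _).ne' (Real.exp_pos _).ne', Real.log_exp, Real.log_exp] at h1
    have h2 : (n : ℝ) * Real.log N ≤ (N : ℝ) ^ (N ^ 3) * Real.log N :=
      mul_le_mul_of_nonneg_right hnN' (by linarith)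
    have h3 : ε / N ≤ 1 := by rw [div_le_one hN0]; rcases hε with rfl | rfl <;> linarith
    have h4 : 1 / (N : ℝ) ≤ 1 := by rw [div_le_one hN0]; linarith
    linarith

/-- From the lower bound `c' u^{1/2} log log log u ≤ (c/2) x^{1/2} log N` needed at the end: given
`u^{1/2} ≤ 2x^{1/2}` and `log log log u ≤ 5 log N`. [folklore] -/
theorem gauge_le {c x u L : ℝ} (hc : 0 < c) (hx : 0 ≤ x ^ (1 / 2 : ℝ)) (hu : 0 ≤ u ^ (1 / 2 : ℝ))
    (hL : 0 ≤ L) (husq : u ^ (1 / 2 : ℝ) ≤ 2 * x ^ (1 / 2 : ℝ))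
    (hlll : Real.log (Real.log (Real.log u)) ≤ 5 * L) :
    c / 20 * (u ^ (1 / 2 : ℝ) * Real.log (Real.log (Real.log u))) ≤ c / 2 * x ^ (1 / 2 : ℝ) * L := by
  rcases le_or_gt (Real.log (Real.log (Real.log u))) 0 with hneg | hpos
  · have h1 : c / 20 * (u ^ (1 / 2 : ℝ) * Real.log (Real.log (Real.log u))) ≤ 0 := by
      have := mul_nonpos_of_nonneg_of_nonpos hu hneg
      have hc' : 0 ≤ c / 20 := by positivity
      nlinarith
    have h2 : 0 ≤ c / 2 * x ^ (1 / 2 : ℝ) * L := by positivity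
    linarith
  · calc c / 20 * (u ^ (1 / 2 : ℝ) * Real.log (Real.log (Real.log u)))
        ≤ c / 20 * ((2 * x ^ (1 / 2 : ℝ)) * (5 * L)) := by
          refine mul_le_mul_of_nonneg_left ?_ (by positivity)
          exact mul_le_mul husq hlll hpos.le (by positivity)
      _ = c / 2 * x ^ (1 / 2 : ℝ) * L := by ring

/-- **The `Ω₋` point** (from `x = N^n e^{1/N}`). [cite: MontgomeryVaughan2007, Thm. 15.11 (proof)] -/
theorem exists_point_neg {c C C₉ : ℝ} (hc : 0 < c) {N n : ℕ} (hN : 2516 ≤ N) (hn1 : 1 ≤ n)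
    (hnN : n ≤ N ^ (N ^ 3)) (hlogN : C + |C₉| + 1 ≤ c / 2 * Real.log N)
    (h9 : ∀ x : ℝ, 4 ≤ x → ∀ δ : ℝ, 1 / (2 * x) ≤ δ → δ ≤ 1 / 2 →
      |1 / ((Real.exp δ - Real.exp (-δ)) * x) *
            (∫ u in (Real.exp (-δ) * x)..(Real.exp δ * x), (ψ u - u)) +
          x ^ (1 / 2 : ℝ) * littlewoodSum δ x| ≤ C₉ * x ^ (1 / 2 : ℝ))
    {x : ℝ} (hx : x = Real.exp (n * Real.log N + 1 / N))
    (hplus : c * Real.log N - C ≤ littlewoodSum (1 / N) x) :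
    ∃ u : ℝ, (N : ℝ) / 4 ≤ u ∧
      ψ u - u < -(c / 20 * (u ^ (1 / 2 : ℝ) * Real.log (Real.log (Real.log u)))) := by
  obtain ⟨hxlow, hδx, hu⟩ := dirichletPoint_bounds hN hn1 hnN (Or.inl rfl) hx
  have hN' : (2516 : ℝ) ≤ N := by exact_mod_cast hN
  have hN0 : (0 : ℝ) < N := by linarith
  have hx4 : 4 ≤ x := by linarith
  have hx0 : 0 < x := by linarith
  have hX0 : 0 < x ^ (1 / 2 : ℝ) := Real.rpow_pos_of_pos hx0 _
  have hδ2 : 1 / (N : ℝ) ≤ 1 / 2 := by rw [div_le_div_iff₀ hN0 two_pos]; linarith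
  have hlogN0 : 0 ≤ Real.log N := Real.log_nonneg (by linarith)
  have h15 := h9 x hx4 (1 / N) hδx hδ2
  have hNinv : (0 : ℝ) < 1 / N := by positivity
  have hab : Real.exp (-(1 / N)) * x < Real.exp (1 / N) * x :=
    mul_lt_mul_of_pos_right (Real.exp_lt_exp.2 (by linarith)) hx0
  have ediv : (∫ u in (Real.exp (-(1 / N)) * x)..(Real.exp (1 / N) * x), (ψ u - u)) /
      ((Real.exp (1 / N) - Real.exp (-(1 / N))) * x) =
      1 / ((Real.exp (1 / N) - Real.exp (-(1 / N))) * x) *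
        ∫ u in (Real.exp (-(1 / N)) * x)..(Real.exp (1 / N) * x), (ψ u - u) := by
    rw [one_div_mul_eq_div]
  have hba : Real.exp (1 / N) * x - Real.exp (-(1 / N)) * x = (Real.exp (1 / N) - Real.exp (-(1 / N))) * x := by
    ring
  have havg : (∫ u in (Real.exp (-(1 / N)) * x)..(Real.exp (1 / N) * x), (ψ u - u)) /
      (Real.exp (1 / N) * x - Real.exp (-(1 / N)) * x) < -(c / 2 * x ^ (1 / 2 : ℝ) * Real.log N) := by
    rw [hba, ediv]
    have h1 := (abs_le.1 h15).2
    have h2 : x ^ (1 / 2 : ℝ) * (c * Real.log N - C) ≤ x ^ (1 / 2 : ℝ) * littlewoodSum (1 / N) x :=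
      mul_le_mul_of_nonneg_left hplus hX0.le
    have h4 : C₉ * x ^ (1 / 2 : ℝ) ≤ |C₉| * x ^ (1 / 2 : ℝ) :=
      mul_le_mul_of_nonneg_right (le_abs_self _) hX0.le
    nlinarith
  obtain ⟨u, hu', hfu⟩ := exists_lt_of_average_lt hab
    ((NicolasJ.intervalIntegrable_psi _ _).sub (continuous_id.intervalIntegrable _ _)) havg
  obtain ⟨hulow, husq, hlll⟩ := hu u hu'
  refine ⟨u, hulow, lt_of_lt_of_le hfu ?_⟩
  rw [neg_le_neg_iff]
  exact gauge_le hc hX0.le (Real.rpow_nonneg (by linarith) _) hlogN0 husq hlll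

/-- **The `Ω₊` point** (from `x = N^n e^{−1/N}`). [cite: MontgomeryVaughan2007, Thm. 15.11 (proof)] -/
theorem exists_point_pos {c C C₉ : ℝ} (hc : 0 < c) {N n : ℕ} (hN : 2516 ≤ N) (hn1 : 1 ≤ n)
    (hnN : n ≤ N ^ (N ^ 3)) (hlogN : C + |C₉| + 1 ≤ c / 2 * Real.log N)
    (h9 : ∀ x : ℝ, 4 ≤ x → ∀ δ : ℝ, 1 / (2 * x) ≤ δ → δ ≤ 1 / 2 →
      |1 / ((Real.exp δ - Real.exp (-δ)) * x) *
            (∫ u in (Real.exp (-δ) * x)..(Real.exp δ * x), (ψ u - u)) +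
          x ^ (1 / 2 : ℝ) * littlewoodSum δ x| ≤ C₉ * x ^ (1 / 2 : ℝ))
    {x : ℝ} (hx : x = Real.exp (n * Real.log N + (-1) / N))
    (hminus : littlewoodSum (1 / N) x ≤ -(c * Real.log N - C)) :
    ∃ u : ℝ, (N : ℝ) / 4 ≤ u ∧
      c / 20 * (u ^ (1 / 2 : ℝ) * Real.log (Real.log (Real.log u))) < ψ u - u := by
  obtain ⟨hxlow, hδx, hu⟩ := dirichletPoint_bounds hN hn1 hnN (Or.inr rfl) hx
  have hN' : (2516 : ℝ) ≤ N := by exact_mod_cast hN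
  have hN0 : (0 : ℝ) < N := by linarith
  have hx4 : 4 ≤ x := by linarith
  have hx0 : 0 < x := by linarith
  have hX0 : 0 < x ^ (1 / 2 : ℝ) := Real.rpow_pos_of_pos hx0 _
  have hδ2 : 1 / (N : ℝ) ≤ 1 / 2 := by rw [div_le_div_iff₀ hN0 two_pos]; linarith
  have hlogN0 : 0 ≤ Real.log N := Real.log_nonneg (by linarith)
  have h15 := h9 x hx4 (1 / N) hδx hδ2
  have hNinv : (0 : ℝ) < 1 / N := by positivity
  have hab : Real.exp (-(1 / N)) * x < Real.exp (1 / N) * x :=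
    mul_lt_mul_of_pos_right (Real.exp_lt_exp.2 (by linarith)) hx0
  have ediv : (∫ u in (Real.exp (-(1 / N)) * x)..(Real.exp (1 / N) * x), (ψ u - u)) /
      ((Real.exp (1 / N) - Real.exp (-(1 / N))) * x) =
      1 / ((Real.exp (1 / N) - Real.exp (-(1 / N))) * x) *
        ∫ u in (Real.exp (-(1 / N)) * x)..(Real.exp (1 / N) * x), (ψ u - u) := by
    rw [one_div_mul_eq_div]
  have hba : Real.exp (1 / N) * x - Real.exp (-(1 / N)) * x = (Real.exp (1 / N) - Real.exp (-(1 / N))) * x := by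
    ring
  have havg : c / 2 * x ^ (1 / 2 : ℝ) * Real.log N <
      (∫ u in (Real.exp (-(1 / N)) * x)..(Real.exp (1 / N) * x), (ψ u - u)) /
        (Real.exp (1 / N) * x - Real.exp (-(1 / N)) * x) := by
    rw [hba, ediv]
    have h1 := (abs_le.1 h15).1
    have h2 : x ^ (1 / 2 : ℝ) * littlewoodSum (1 / N) x ≤ x ^ (1 / 2 : ℝ) * (-(c * Real.log N - C)) :=
      mul_le_mul_of_nonneg_left hminus hX0.le
    have h4 : C₉ * x ^ (1 / 2 : ℝ) ≤ |C₉| * x ^ (1 / 2 : ℝ) :=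
      mul_le_mul_of_nonneg_right (le_abs_self _) hX0.le
    nlinarith
  obtain ⟨u, hu', hfu⟩ := exists_gt_of_lt_average hab
    ((NicolasJ.intervalIntegrable_psi _ _).sub (continuous_id.intervalIntegrable _ _)) havg
  obtain ⟨hulow, husq, hlll⟩ := hu u hu'
  exact ⟨u, hulow, lt_of_le_of_lt (gauge_le hc hX0.le (Real.rpow_nonneg (by linarith) _) hlogN0 husq hlll) hfu⟩

/-! ### Littlewood's theorem for `ψ` under RH -/

/-- **MV Theorem 15.11 (15.22) under RH** (Littlewood 1914): assuming the Riemann Hypothesis there is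
`c > 0` with
`ψ(u) − u ≥ c u^{1/2} log log log u` for arbitrarily large `u` and `ψ(u) − u ≤ −c u^{1/2} log log log u`
for arbitrarily large `u`, i.e. `ψ(x) − x = Ω±(x^{1/2} log log log x)`. Proof as printed (MV p. 479):
at `x = N^n e^{±1/N}` (Lemma 15.10, `littlewoodSum_bounds`) the average of `ψ(u) − u` over
`[e^{−1/N}x, e^{1/N}x]` is `∓(c log N − C)x^{1/2} + O(x^{1/2})` by Lemma 15.9, hence some `u` in that
interval has `ψ(u) − u` of that size and sign, and `log log log u ≤ 5 log N`.
[cite: MontgomeryVaughan2007, Thm. 15.11 (15.22)] -/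
theorem chebyshevPsi_littlewood_of_RH (hRH : RiemannHypothesis) :
    ∃ c : ℝ, 0 < c ∧
      (∃ᶠ u in atTop, c * (u ^ (1 / 2 : ℝ) * Real.log (Real.log (Real.log u))) ≤ ψ u - u) ∧
      (∃ᶠ u in atTop, ψ u - u ≤ -(c * (u ^ (1 / 2 : ℝ) * Real.log (Real.log (Real.log u))))) := by
  obtain ⟨C₉, h9'⟩ := MontgomeryVaughan2007_lemma15_9_holds hRH
  obtain ⟨c, hc, C, hNC⟩ := littlewoodSum_bounds hRH
  -- threshold `N₀`: `N ≥ 2516` and `(c/2) log N ≥ C + |C₉| + 1`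
  obtain ⟨N₀, hN₀⟩ : ∃ N₀ : ℕ, ∀ N : ℕ, N₀ ≤ N → 2516 ≤ N ∧ C + |C₉| + 1 ≤ c / 2 * Real.log N := by
    refine ⟨max 2516 (⌈Real.exp (2 * (|C| + |C₉| + 1) / c)⌉₊), fun N hN ↦ ⟨le_trans (le_max_left _ _) hN, ?_⟩⟩
    have h2' : (⌈Real.exp (2 * (|C| + |C₉| + 1) / c)⌉₊ : ℝ) ≤ N := by
      exact_mod_cast (le_max_right 2516 _).trans hN
    have h2 : Real.exp (2 * (|C| + |C₉| + 1) / c) ≤ N := (Nat.le_ceil _).trans h2'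
    have h3 : 2 * (|C| + |C₉| + 1) / c ≤ Real.log N := by
      rw [Real.le_log_iff_exp_le (lt_of_lt_of_le (Real.exp_pos _) h2)]; exact h2
    rw [div_le_iff₀ hc] at h3
    have := le_abs_self C
    nlinarith
  have step : ∀ N : ℕ, N₀ ≤ N →
      (∃ u : ℝ, (N : ℝ) / 4 ≤ u ∧
          ψ u - u < -(c / 20 * (u ^ (1 / 2 : ℝ) * Real.log (Real.log (Real.log u))))) ∧
      (∃ u : ℝ, (N : ℝ) / 4 ≤ u ∧
          c / 20 * (u ^ (1 / 2 : ℝ) * Real.log (Real.log (Real.log u))) < ψ u - u) := by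
    intro N hN
    obtain ⟨h2516, hlogN⟩ := hN₀ N hN
    obtain ⟨n, hn1, hnN, hplus, hminus⟩ := hNC N h2516
    exact ⟨exists_point_neg hc h2516 hn1 hnN hlogN h9' rfl hplus,
      exists_point_pos hc h2516 hn1 hnN hlogN h9' rfl hminus⟩
  refine ⟨c / 20, by positivity, ?_, ?_⟩
  · rw [Filter.frequently_atTop]
    intro a
    obtain ⟨-, ⟨u, hu, hlt⟩⟩ := step (max N₀ (⌈4 * a⌉₊)) (le_max_left _ _)
    refine ⟨u, ?_, hlt.le⟩
    have h1 : 4 * a ≤ ((max N₀ (⌈4 * a⌉₊) : ℕ) : ℝ) :=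
      (Nat.le_ceil (4 * a)).trans (by exact_mod_cast le_max_right _ _)
    linarith
  · rw [Filter.frequently_atTop]
    intro a
    obtain ⟨⟨u, hu, hlt⟩, -⟩ := step (max N₀ (⌈4 * a⌉₊)) (le_max_left _ _)
    refine ⟨u, ?_, hlt.le⟩
    have h1 : 4 * a ≤ ((max N₀ (⌈4 * a⌉₊) : ℕ) : ℝ) :=
      (Nat.le_ceil (4 * a)).trans (by exact_mod_cast le_max_right _ _)
    linarith

end LittlewoodRH

end Literature.NumberTheory.LFunctions
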